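import Literature.MathematicalPhysics.QuantumFieldTheory.Balaban1983to89.T4TermwiseChainUN
import Literature.MathematicalPhysics.QuantumFieldTheory.Balaban1983to89.B7Prop1Local

/-!
# TermwiseLocal — telescoping of a covariantly transported field along segments and tree contours INSIDE A
COORDINATE BOX, and the window box `Δ(p′_y)` of Bałaban's one-step average: the lattice half of the per-window
LOCALISATION of the term-wise `U(N)` chain

Cell `pub-balaban`, rung (B)+1 sub-cell t4, lineage `b2b-balaban-t4-ne7-p1` (node U5 = spine estimate NE7, TERM-WISE
member; generation 17), record `t4/T4-EST-NE7-P1.md` §22.  HONEST FRAMING (page 1): pure YM₄ on a FIXED FINITE torus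
T⁴; the target of the sub-cell is the `ε → 0` limit of unit-scale averaged expectations of gauge-invariant observables,
CONDITIONAL on BetaPertH and the nine spine estimates (0/9 proved); NOT infinite volume, NOT a mass gap, NOT the Clay
problem.  NE7 is NOT PRINTED in [Balaban1984PropagatorsI]–[Balaban1989LargeFieldII] and NOT proved here.  This module
is [folklore] lattice bookkeeping over the tree's `B7Prop1Explicit` (words, transport (9), the tree contour `Γ_{y,x}`)
and `B7Prop1Local` (coordinate boxes `InBox`/`PlaqIn`/`AgreeOn`, the printed locality region `Δ(p′)` (46) =
`[z, deltaHi L z μ ν]`); no sentence of print is used as a fact; nothing printed is asserted.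

WHY (record (21b), route L-loc).  The level-graded ledger theorem of `Support/TermwiseLevelsLedger` asks the one-step
binders (bch)(sz)(osc) PER WINDOW at the window's regularity level, while the `U(N)` producers of generations 11–13
(`T4TermwiseChainUN.bch_PhiU_four`, `norm_phiU_le_four`, `norm_PhiU_sub_PhiU`) take (44) and (44∇) UNIFORMLY over
`ℤ^d`.  Print states the locality that closes the gap ([Balaban1985Averaging] p. 24 «this definition is local …», p. 25
«it is a local result; the bound above depends on bounds for `V(∂p) − 1` on `Δ(p′)`», kernel-checked for (42)/(51) in
`B7Prop1Local`).  This module supplies the one missing lattice lemma for the OSCILLATION binder — telescoping along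
the tree contour with the one-bond hypothesis restricted to the bonds of a box (the global form is
`T4TermwiseOscillation.hol_conj_osc`) — and the elementary geometry of the window box; the companion
`Support/TermwiseLocalBinders` localises the three binders, `Support/TermwiseLocalLedger` feeds the ledger.

WHAT IS PROVED ([folklore]; any normed ring with `‖1‖ = 1`, transporters in `U1`).
§1 `norm_inv_conj_sub` (`‖u⁻¹Xu − Y‖ = ‖X − uYu⁻¹‖`); `step_osc_of_bond_osc_on` (the letter form of the one-bond
   covariant oscillation hypothesis from its forward-bond form, for bonds of the box — the local
   `T4TermwiseOscillation.step_osc_of_bond_osc`); `conjOsc_seg`, `conjOsc_seg_int`, `conjOsc_flatMap_seg` (telescoping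
   along straight and broken segments staying in the box, mirroring `B7Prop1Local.hol_seg_congr` /
   `hol_seg_int_congr` / `hol_flatMap_seg_congr`); **`conjOsc_treeWord`**: if `‖V(b)φ(x+e_κ)V(b)⁻¹ − φ(x)‖ ≤ α₁` for
   every bond `b = ⟨x, x+e_κ⟩` of a coordinate box containing `p` and `p + v`, then
   `‖V(Γ_{p,p+v}) φ(p+v) V(Γ_{p,p+v})⁻¹ − φ(p)‖ ≤ |v|₁·α₁`.
§2 `inBox_corner`, `inBox_farCorner'`, `plaqIn_zpos` (every window position of `T4TermwiseTorus.zpos` together with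
   its unit plaquette lies in `Δ(p′)`, plane `μ ≠ ν`), `inBox_corners_of_plaqIn`.

NOT DELIVERED here: the binders themselves (companion), anything about print.  Value = lattice lemmas; NOT NE7, NOT
summit progress.

References (LOCATIONS only): [Balaban1985Averaging] T. Bałaban, Averaging operations for lattice gauge theories,
Commun. Math. Phys. 98 (1985) 17–51, (9) p. 18, (42) p. 23, p. 24 (locality sentence after (43)), (46)–(51) pp. 25–26.
-/

noncomputable section

open scoped BigOperators Matrix.Norms.L2Operator
open Finset

namespace Summit.QuantumFields.BalabanUV.T4Continuum.TermwiseLocal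

open Literature.MathematicalPhysics.QuantumFieldTheory.Balaban1983to89
open B7Prop1Explicit B7Prop2Explicit B7Prop1Local T4TermwiseBCH T4TermwiseTorus T4TermwiseUN T4TermwiseChainUN
open T4TermwiseOscillation (norm_conj_sub_conj farCorner l1_zpos_sub_farCorner_le)

/-! ## §1 Telescoping along segments and tree contours INSIDE A BOX (the local form of
`T4TermwiseOscillation.hol_conj_osc`) -/

section Words

variable {d : ℕ} {𝔸 : Type*} [NormedRing 𝔸] [NormOneClass 𝔸]
variable {lo hi : Site d} {V : Site d → Fin d → 𝔸ˣ} {φ : Site d → 𝔸} {α₁ : ℝ}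

/-- `‖u⁻¹ X u − Y‖ = ‖X − u Y u⁻¹‖` for `u ∈ U1` (conjugation by `u⁻¹` is an isometry). [folklore] -/
theorem norm_inv_conj_sub {u : 𝔸ˣ} (hu : u ∈ U1 𝔸) (X Y : 𝔸) :
    ‖((u⁻¹ : 𝔸ˣ) : 𝔸) * X * (u : 𝔸) - Y‖ = ‖X - (u : 𝔸) * Y * ((u⁻¹ : 𝔸ˣ) : 𝔸)‖ := by
  have e1 : ((u⁻¹ : 𝔸ˣ) : 𝔸) * X * (u : 𝔸) - Y
      = ((u⁻¹ : 𝔸ˣ) : 𝔸) * (X - (u : 𝔸) * Y * ((u⁻¹ : 𝔸ˣ) : 𝔸)) * (((u⁻¹)⁻¹ : 𝔸ˣ) : 𝔸) := by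
    have h2 : ((u⁻¹ : 𝔸ˣ) : 𝔸) * ((u : 𝔸) * Y * ((u⁻¹ : 𝔸ˣ) : 𝔸)) * (u : 𝔸)
        = (((u⁻¹ : 𝔸ˣ) : 𝔸) * (u : 𝔸)) * Y * (((u⁻¹ : 𝔸ˣ) : 𝔸) * (u : 𝔸)) := by noncomm_ring
    rw [inv_inv, mul_sub, sub_mul, h2, Units.inv_mul, one_mul, mul_one]
  rw [e1, norm_units_conj_eq ((U1 𝔸).inv_mem hu)]

/-- One forward bond inside the box, as a letter step: from the BOND form of the covariant one-step oscillation
hypothesis on the bonds of the box, both orientations (backward letters by the isometry of conjugation). [folklore] -/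
theorem step_osc_of_bond_osc_on (hV : ∀ x κ, V x κ ∈ U1 𝔸)
    (hbond : ∀ (x : Site d) (κ : Fin d), InBox lo hi x → InBox lo hi (x + e κ) →
      ‖(V x κ : 𝔸) * φ (x + e κ) * (((V x κ)⁻¹ : 𝔸ˣ) : 𝔸) - φ x‖ ≤ α₁)
    (x : Site d) (l : Letter d) (hx : InBox lo hi x) (hxl : InBox lo hi (x + l.vec)) :
    ‖((stepHol V x l : 𝔸ˣ) : 𝔸) * φ (x + l.vec) * (((stepHol V x l)⁻¹ : 𝔸ˣ) : 𝔸) - φ x‖ ≤ α₁ := by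
  obtain ⟨κ, b⟩ := l
  cases b
  · rw [stepHol_false, Letter.vec_false, inv_inv, ← sub_eq_add_neg]
    have hxl' : InBox lo hi (x - e κ) := by rw [sub_eq_add_neg, ← Letter.vec_false]; exact hxl
    have h := hbond (x - e κ) κ hxl' (by rw [sub_add_cancel]; exact hx)
    rw [sub_add_cancel] at h
    have hu : V (x - e κ) κ ∈ U1 𝔸 := hV _ _
    rw [norm_inv_conj_sub hu, norm_sub_rev]
    exact h
  · rw [stepHol_true, Letter.vec_true]
    exact hbond x κ hx (by rw [← Letter.vec_true]; exact hxl)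

/-- Telescoping along a forward segment `[p, p + n e_κ]` inside the box. [folklore] -/
theorem conjOsc_seg (hV : ∀ x κ, V x κ ∈ U1 𝔸)
    (hbond : ∀ (x : Site d) (κ : Fin d), InBox lo hi x → InBox lo hi (x + e κ) →
      ‖(V x κ : 𝔸) * φ (x + e κ) * (((V x κ)⁻¹ : 𝔸ˣ) : 𝔸) - φ x‖ ≤ α₁) (κ : Fin d) :
    ∀ (n : ℕ) (p : Site d), InBox lo hi p → InBox lo hi (p + (n : ℤ) • e κ) →
      ‖((hol V p (seg κ n) : 𝔸ˣ) : 𝔸) * φ (p + (n : ℤ) • e κ) * (((hol V p (seg κ n))⁻¹ : 𝔸ˣ) : 𝔸) - φ p‖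
        ≤ n * α₁
  | 0, p, _, _ => by simp
  | n + 1, p, hp, hpn => by
    have hpe : InBox lo hi (p + e κ) := inBox_add_e hp hpn
    have he : p + e κ + (n : ℤ) • e κ = p + ((n + 1 : ℕ) : ℤ) • e κ := by
      push_cast; rw [add_smul, one_smul]; abel
    have hpn' : InBox lo hi (p + e κ + (n : ℤ) • e κ) := by rw [he]; exact hpn
    have ih := conjOsc_seg hV hbond κ n (p + e κ) hpe hpn'
    have hs : V p κ ∈ U1 𝔸 := hV p κ
    have h1 := hbond p κ hp hpe
    rw [seg_natCast, List.replicate_succ, hol_cons, stepHol_true, Letter.vec_true, ← seg_natCast, ← he]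
    have key : ((V p κ * hol V (p + e κ) (seg κ n) : 𝔸ˣ) : 𝔸) * φ (p + e κ + (n : ℤ) • e κ)
          * (((V p κ * hol V (p + e κ) (seg κ n))⁻¹ : 𝔸ˣ) : 𝔸) - φ p
        = (V p κ : 𝔸) * (((hol V (p + e κ) (seg κ n) : 𝔸ˣ) : 𝔸) * φ (p + e κ + (n : ℤ) • e κ)
            * (((hol V (p + e κ) (seg κ n))⁻¹ : 𝔸ˣ) : 𝔸) - φ (p + e κ)) * (((V p κ)⁻¹ : 𝔸ˣ) : 𝔸)
          + ((V p κ : 𝔸) * φ (p + e κ) * (((V p κ)⁻¹ : 𝔸ˣ) : 𝔸) - φ p) := by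
      rw [mul_inv_rev, Units.val_mul, Units.val_mul]
      noncomm_ring
    rw [key]
    calc _ ≤ ‖(V p κ : 𝔸) * (((hol V (p + e κ) (seg κ n) : 𝔸ˣ) : 𝔸) * φ (p + e κ + (n : ℤ) • e κ)
            * (((hol V (p + e κ) (seg κ n))⁻¹ : 𝔸ˣ) : 𝔸) - φ (p + e κ)) * (((V p κ)⁻¹ : 𝔸ˣ) : 𝔸)‖
          + ‖(V p κ : 𝔸) * φ (p + e κ) * (((V p κ)⁻¹ : 𝔸ˣ) : 𝔸) - φ p‖ := norm_add_le _ _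
      _ ≤ n * α₁ + α₁ := by
          rw [norm_units_conj_eq hs]
          exact add_le_add ih h1
      _ = ((n + 1 : ℕ) : ℝ) * α₁ := by push_cast; ring

/-- Telescoping along a segment `[p, p + n e_κ]`, `n ∈ ℤ`, inside the box (backward segments by reversal and the
isometry of conjugation). [folklore] -/
theorem conjOsc_seg_int (hV : ∀ x κ, V x κ ∈ U1 𝔸)
    (hbond : ∀ (x : Site d) (κ : Fin d), InBox lo hi x → InBox lo hi (x + e κ) →
      ‖(V x κ : 𝔸) * φ (x + e κ) * (((V x κ)⁻¹ : 𝔸ˣ) : 𝔸) - φ x‖ ≤ α₁)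
    (κ : Fin d) (n : ℤ) (p : Site d) (hp : InBox lo hi p) (hpn : InBox lo hi (p + n • e κ)) :
    ‖((hol V p (seg κ n) : 𝔸ˣ) : 𝔸) * φ (p + n • e κ) * (((hol V p (seg κ n))⁻¹ : 𝔸ˣ) : 𝔸) - φ p‖
      ≤ n.natAbs * α₁ := by
  obtain ⟨m, rfl | rfl⟩ := Int.eq_nat_or_neg n
  · simpa using conjOsc_seg hV hbond κ m p hp hpn
  · -- backward segment: `hol V p (seg κ (-m)) = (hol V (p - m e) (seg κ m))⁻¹`
    have hx : p = p + -(m : ℤ) • e κ + disp (seg κ m) := by rw [disp_seg, neg_smul, neg_add_cancel_right]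
    have hq : p + -(m : ℤ) • e κ + (m : ℤ) • e κ = p := by rw [neg_smul, neg_add_cancel_right]
    have hfwd := conjOsc_seg hV hbond κ m (p + -(m : ℤ) • e κ) hpn (by rw [hq]; exact hp)
    rw [hq] at hfwd
    have hHU : hol V (p + -(m : ℤ) • e κ) (seg κ m) ∈ U1 𝔸 := hol_mem hV _ _
    rw [← revWord_seg, hol_revWord' V _ _ hx, Int.natAbs_neg, Int.natAbs_natCast]
    simp only [inv_inv]
    rw [norm_inv_conj_sub hHU, norm_sub_rev]
    exact hfwd

/-- Telescoping along a broken line changing the coordinates listed in `s` one at a time, inside the box. [folklore] -/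
theorem conjOsc_flatMap_seg (hV : ∀ x κ, V x κ ∈ U1 𝔸)
    (hbond : ∀ (x : Site d) (κ : Fin d), InBox lo hi x → InBox lo hi (x + e κ) →
      ‖(V x κ : 𝔸) * φ (x + e κ) * (((V x κ)⁻¹ : 𝔸ˣ) : 𝔸) - φ x‖ ≤ α₁) (v : Site d) :
    ∀ (s : List (Fin d)), s.Nodup → ∀ p : Site d, InBox lo hi p →
      (∀ κ ∈ s, lo κ ≤ p κ + v κ ∧ p κ + v κ ≤ hi κ) →
      ‖((hol V p (s.flatMap fun κ => seg κ (v κ)) : 𝔸ˣ) : 𝔸) * φ (p + disp (s.flatMap fun κ => seg κ (v κ)))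
          * (((hol V p (s.flatMap fun κ => seg κ (v κ)))⁻¹ : 𝔸ˣ) : 𝔸) - φ p‖
        ≤ ((s.map fun κ => (v κ).natAbs).sum : ℕ) * α₁
  | [], _, p, _, _ => by simp
  | κ :: s, hnd, p, hp, hv => by
    obtain ⟨hκs, hs⟩ := List.nodup_cons.mp hnd
    have hκ := hv κ (by simp)
    have hpκ : InBox lo hi (p + v κ • e κ) := fun i => by
      rw [add_zsmul_e_apply]
      by_cases hi : i = κ
      · subst hi; simpa using hκ
      · simpa [hi] using hp i
    have hv' : ∀ κ' ∈ s, lo κ' ≤ (p + v κ • e κ) κ' + v κ' ∧ (p + v κ • e κ) κ' + v κ' ≤ hi κ' := by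
      intro κ' hκ'
      have hne : κ' ≠ κ := fun h' => hκs (h' ▸ hκ')
      rw [add_zsmul_e_apply, if_neg hne, add_zero]
      exact hv κ' (by simp [hκ'])
    have ih := conjOsc_flatMap_seg hV hbond v s hs (p + v κ • e κ) hpκ hv'
    have h1 := conjOsc_seg_int hV hbond κ (v κ) p hp hpκ
    set W := s.flatMap fun κ => seg κ (v κ) with hW
    have hHU : hol V p (seg κ (v κ)) ∈ U1 𝔸 := hol_mem hV _ _
    rw [List.flatMap_cons, hol_append, disp_append, disp_seg, List.map_cons, List.sum_cons, ← hW]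
    have key : ((hol V p (seg κ (v κ)) * hol V (p + v κ • e κ) W : 𝔸ˣ) : 𝔸) * φ (p + (v κ • e κ + disp W))
          * (((hol V p (seg κ (v κ)) * hol V (p + v κ • e κ) W)⁻¹ : 𝔸ˣ) : 𝔸) - φ p
        = ((hol V p (seg κ (v κ)) : 𝔸ˣ) : 𝔸) * (((hol V (p + v κ • e κ) W : 𝔸ˣ) : 𝔸)
            * φ (p + v κ • e κ + disp W) * (((hol V (p + v κ • e κ) W)⁻¹ : 𝔸ˣ) : 𝔸) - φ (p + v κ • e κ))
            * (((hol V p (seg κ (v κ)))⁻¹ : 𝔸ˣ) : 𝔸)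
          + (((hol V p (seg κ (v κ)) : 𝔸ˣ) : 𝔸) * φ (p + v κ • e κ) * (((hol V p (seg κ (v κ)))⁻¹ : 𝔸ˣ) : 𝔸)
            - φ p) := by
      rw [mul_inv_rev, Units.val_mul, Units.val_mul, ← add_assoc]
      noncomm_ring
    rw [key]
    calc _ ≤ ‖((hol V p (seg κ (v κ)) : 𝔸ˣ) : 𝔸) * (((hol V (p + v κ • e κ) W : 𝔸ˣ) : 𝔸)
            * φ (p + v κ • e κ + disp W) * (((hol V (p + v κ • e κ) W)⁻¹ : 𝔸ˣ) : 𝔸) - φ (p + v κ • e κ))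
            * (((hol V p (seg κ (v κ)))⁻¹ : 𝔸ˣ) : 𝔸)‖
          + ‖((hol V p (seg κ (v κ)) : 𝔸ˣ) : 𝔸) * φ (p + v κ • e κ) * (((hol V p (seg κ (v κ)))⁻¹ : 𝔸ˣ) : 𝔸)
            - φ p‖ := norm_add_le _ _
      _ ≤ ((s.map fun κ => (v κ).natAbs).sum : ℕ) * α₁ + (v κ).natAbs * α₁ := by
          rw [norm_units_conj_eq hHU]
          exact add_le_add ih h1
      _ = (((v κ).natAbs + (s.map fun κ => (v κ).natAbs).sum : ℕ) : ℝ) * α₁ := by push_cast; ring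

/-- **TELESCOPING ALONG THE TREE CONTOUR `Γ_{p, p+v}` INSIDE A BOX** (the local form of
`T4TermwiseOscillation.hol_conj_osc` on tree words): if the covariant one-step oscillation of `φ` is `≤ α₁` on the
bonds of a coordinate box containing `p` and `p + v`, then `‖V(Γ) φ(p + v) V(Γ)⁻¹ − φ(p)‖ ≤ |v|₁·α₁`. [folklore] -/
theorem conjOsc_treeWord (hV : ∀ x κ, V x κ ∈ U1 𝔸)
    (hbond : ∀ (x : Site d) (κ : Fin d), InBox lo hi x → InBox lo hi (x + e κ) →
      ‖(V x κ : 𝔸) * φ (x + e κ) * (((V x κ)⁻¹ : 𝔸ˣ) : 𝔸) - φ x‖ ≤ α₁)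
    (p v : Site d) (hp : InBox lo hi p) (hpv : InBox lo hi (p + v)) :
    ‖((hol V p (treeWord v) : 𝔸ˣ) : 𝔸) * φ (p + v) * (((hol V p (treeWord v))⁻¹ : 𝔸ˣ) : 𝔸) - φ p‖
      ≤ (l1 v : ℝ) * α₁ := by
  have h := conjOsc_flatMap_seg hV hbond v _ (List.nodup_reverse.mpr (List.nodup_finRange d)) p hp
    (fun κ _ => by simpa using hpv κ)
  rw [← treeWord] at h
  rw [disp_treeWord] at h
  have hsum : ((List.finRange d).reverse.map fun κ => (v κ).natAbs).sum = l1 v := by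
    rw [List.map_reverse, List.sum_reverse, l1, Fin.sum_univ_def]
  rw [hsum] at h
  exact h

end Words

/-! ## §2 The window box `Δ(p′_y) = [La, La + (L−1)𝟙 + Le_μ + Le_ν]` (B7 (46)): the corner, the far corner, the
window positions and their plaquettes lie in it -/

section WindowBox

variable {d : ℕ}

/-- The corner `z` lies in `[z, deltaHi L z μ ν]` (`1 ≤ L`). [folklore] -/
theorem inBox_corner {L : ℕ} (hL : 1 ≤ L) (z : Site d) (μ ν : Fin d) : InBox z (deltaHi L z μ ν) z := fun i => by
  simp only [deltaHi]
  have : (1 : ℤ) ≤ L := by exact_mod_cast hL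
  split_ifs <;> constructor <;> omega

/-- The far corner `z + Le_μ + Le_ν` lies in `[z, deltaHi L z μ ν]` (`1 ≤ L`, `μ ≠ ν`). [folklore] -/
theorem inBox_farCorner' {L : ℕ} (hL : 1 ≤ L) (z : Site d) {μ ν : Fin d} (hμν : μ ≠ ν) :
    InBox z (deltaHi L z μ ν) (z + (L : ℤ) • e μ + (L : ℤ) • e ν) := fun i => by
  have hne : (μ : ℕ) ≠ ν := fun h => hμν (Fin.ext h)
  have : (1 : ℤ) ≤ L := by exact_mod_cast hL
  simp only [deltaHi, Pi.add_apply, Pi.smul_apply, smul_eq_mul, e_apply, mul_ite, mul_one, mul_zero]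
  split_ifs <;> omega

/-- A window position together with its unit plaquette in the plane `(μ, ν)`, `μ ≠ ν`, lies in the window box
(coordinates relative to the corner: offset `< L`, plus `< L` steps along `e_μ`, `e_ν`). [folklore] -/
theorem plaqIn_zpos {L : ℕ} {μ ν : Fin d} (hμν : μ ≠ ν) (z : Site d) {s : (Fin d → Fin L) × ℕ × ℕ}
    (hs : s ∈ slots L) : PlaqIn z (deltaHi L z μ ν) (zpos L μ ν z s, μ, ν) := by
  rw [mem_slots] at hs
  have hr : ∀ κ, (0 : ℤ) ≤ boxVec L s.1 κ ∧ boxVec L s.1 κ + 1 ≤ L := fun κ =>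
    ⟨by simp [boxVec], by have := (s.1 κ).isLt; simp only [boxVec]; omega⟩
  have hi : (s.2.1 : ℤ) + 1 ≤ L := by omega
  have hj : (s.2.2 : ℤ) + 1 ≤ L := by omega
  have hne : (μ : ℕ) ≠ ν := fun h => hμν (Fin.ext h)
  constructor
  · intro i
    have := hr i
    simp only [zpos, deltaHi, Pi.add_apply, Pi.smul_apply, smul_eq_mul, e_apply, mul_ite, mul_one, mul_zero]
    split_ifs <;> omega
  · intro i
    have := hr i
    simp only [zpos, deltaHi, Pi.add_apply, Pi.smul_apply, smul_eq_mul, e_apply, mul_ite, mul_one, mul_zero]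
    split_ifs <;> omega

/-- The intermediate corners of a unit plaquette in a box lie in the box. [folklore] -/
theorem inBox_corners_of_plaqIn {lo hi x : Site d} {κ ν : Fin d} (h : PlaqIn lo hi (x, κ, ν)) :
    InBox lo hi x ∧ InBox lo hi (x + e κ) ∧ InBox lo hi (x + e ν) ∧ InBox lo hi (x + e κ + e ν) := by
  obtain ⟨h0, h2⟩ := h
  refine ⟨h0, inBox_of_between h0 h2 fun i => Or.inl ?_, inBox_of_between h0 h2 fun i => Or.inl ?_, h2⟩ <;>
  · simp only [Pi.add_apply, e_apply]
    split_ifs <;> omega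

end WindowBox

end Summit.QuantumFields.BalabanUV.T4Continuum.TermwiseLocal
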